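import Summits.ValiantsHypothesis.ValiantsHypothesis.Theorems.SymmetroidDescartesDerivedPencilRolleWalkDefs
import Summits.ValiantsHypothesis.ValiantsHypothesis.Theorems.KPlusLogSqLawTropicalBSplitDefs

/-!
# Route `KPlusLogSqLaw`, crux `TropicalB` — WALK DESIGNS (the staircase's walk matrix as a tropical design): definitions

HONEST FRAMING.  Definitions file toward the registered stubs `stub_tropThin` / `stub_tropFat` of
`Cruxes/TropicalB/Lines/birth.lean` (crux `Summit.ValiantsHypothesis.ValiantsHypothesis.Theses.KPlusLogSqLaw.TropicalB`,
ledger item `stmt-ValiantsHypothesis-19771`, route `KPlusLogSqLaw`, DRAFT; cell `pub-symmetroid`, seat `val-sym-trop-p1`,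
2026-08-26), NEGATIVE-SIDE CALIBRATION: the route file lists «the translation of the `DPR` walk vocabulary into `IsDominant`
(needed only for the negative side ¬TE)» as not decomposed.  This file only DEFINES the objects; it proves nothing about
`TropicalB`, `KPlusLogSqLaw`, `MatrixDescartes` or `VP ≠ VNP`, and the candidate law `TropExponentLaw` it is aimed at is
recorded DEAD on paper in the tree (`…CensusTropicalKLaw`).

THE WALK DESIGN.  Data: a finite vertex type `V`, `T` edge layers `lay : Fin T → V → V → Option (WEdge K)` (the tree's edge
labels `DPR.WEdge K`: weight `a : ℤ`, class `cls : Fin K`, sign bit), a start vertex `v₀`, a padding class `l₀` and a bonus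
`Ω : ℤ`.  On the index set `Fin (T+1) × V` (pairs (layer, vertex); transported to `Fin m` along an equivalence `ι` in the
proof files) the design has
* DIAGONAL entries `((t,x),(t,x))`: class `l₀`, sign `+1`, valuation `0`;
* LAYER entries, row `(t, x)`, column `(t+1, x')`, when `lay t x x' = some e`: class `e.cls`, sign `e.sgn`, valuation `e.a`;
* BACK entries, row `(T, x)`, column `(0, v₀)`: class `l₀`, sign `+1`, valuation `−Ω`
(`walkEpsP`, `walkValP`; `walkEps`, `walkVal` on `Fin m`).  This is the tree's WalkDet matrix `I − Z₀ − W·u vᵀ` (blueprint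
`Cruxes/DerivedPencilRolle/Lines/staircase-refutation.md` §1) read tropically.  Its present Leibniz terms are the identity and
the WALK TERMS: for a vertex sequence `y : Fin (T+1) → V` with `y 0 = v₀` through present edges (`IsLayWalk`), the
permutation `walkPerm y` — the `(T+1)`-cycle `(0, y 0) → (T, y T) → (T−1, y (T−1)) → ⋯ → (1, y 1) → (0, y 0)` on the CYCLE
POINTS `(t, y t)`, i.e. `(t, y t) ↦ (t − 1, y (t − 1))` cyclically, identity elsewhere — with the class map `walkClsP` (the
edge class on the cycle points of layer `≥ 1`, `l₀` elsewhere).  `walkCostFin` / `walkSgnFin` are the tree's list-recursive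
`DPR.walkCost` / `DPR.walkSign` in `Fin`-indexed form (`edgeAt lay y s = lay s (y s) (y (s+1))`).  The proof files establish the
weight `(m − T)·θ·d l₀ + Ω − walkCostFin`, the sign `(−1)^T · walkSgnFin`, and the STRUCTURE THEOREM (every present term is
the identity or a walk term), so that a uniquely cheapest walk with margin `≥ 1` is a DOMINANT term: the bridge from the
tree's `DPR.stub_stair` (staircase family: `n^L` alternating walks, `K = L+1` classes) to chains of the tropical census row,
i.e. to `¬ TropExponentLaw e` for every `e`.
-/

set_option linter.dupNamespace false
set_option autoImplicit false

namespace Summit.ValiantsHypothesis.ValiantsHypothesis.Theorems.KPlusLogSqLaw.WalkDesign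

open Summit.ValiantsHypothesis.ValiantsHypothesis.Theorems.SymmetroidDescartes.DPR

variable {V : Type*} {T K : ℕ}

/-- the layer edge from row `(t, x)` to column `(t', x')`: present iff `t' = t + 1` and layer `t` has the edge `x → x'`.
[definition of the cell] -/
def layerEdge (lay : Fin T → V → V → Option (WEdge K)) (r c : Fin (T + 1) × V) : Option (WEdge K) :=
  if h : c.1.val = r.1.val + 1 then lay ⟨r.1.val, by have := c.1.isLt; omega⟩ r.2 c.2 else none

/-- `walkEpsP`: the sign/presence datum of the walk design on pairs (row `r`, column `c`): diagonal entries carry the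
padding class `l₀` with sign `+1`; a layer entry carries the class of its edge with the edge's sign `(−1)^neg`; the BACK
entries (row in the last layer `T`, column `(0, v₀)`) carry `l₀` with sign `+1`; everything else is absent.
[definition of the cell] -/
def walkEpsP [DecidableEq V] (lay : Fin T → V → V → Option (WEdge K)) (l₀ : Fin K) (v₀ : V)
    (r c : Fin (T + 1) × V) (l : Fin K) : ℤ :=
  if r = c then (if l = l₀ then 1 else 0)
  else match layerEdge lay r c with
    | some e => if l = e.cls then e.sgn else 0
    | none => if r.1 = Fin.last T ∧ c.1 = 0 ∧ c.2 = v₀ then (if l = l₀ then 1 else 0) else 0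

/-- `walkValP`: the valuation datum of the walk design on pairs: `0` on the diagonal, the edge weight `e.a` on a layer
entry, `−Ω` on the back entries, `0` elsewhere. [definition of the cell] -/
def walkValP [DecidableEq V] (lay : Fin T → V → V → Option (WEdge K)) (Ω : ℤ) (v₀ : V)
    (r c : Fin (T + 1) × V) (_l : Fin K) : ℤ :=
  if r = c then 0
  else match layerEdge lay r c with
    | some e => e.a
    | none => if r.1 = Fin.last T ∧ c.1 = 0 ∧ c.2 = v₀ then -Ω else 0

/-- the walk design on `Fin m`, transported along an equivalence `ι : Fin (T+1) × V ≃ Fin m`: signs/presence.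
[definition of the cell] -/
def walkEps [DecidableEq V] {m : ℕ} (ι : Fin (T + 1) × V ≃ Fin m) (lay : Fin T → V → V → Option (WEdge K))
    (l₀ : Fin K) (v₀ : V) : Fin m → Fin m → Fin K → ℤ :=
  fun a b l => walkEpsP lay l₀ v₀ (ι.symm a) (ι.symm b) l

/-- the walk design on `Fin m`: valuations. [definition of the cell] -/
def walkVal [DecidableEq V] {m : ℕ} (ι : Fin (T + 1) × V ≃ Fin m) (lay : Fin T → V → V → Option (WEdge K))
    (Ω : ℤ) (v₀ : V) : Fin m → Fin m → Fin K → ℤ :=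
  fun a b l => walkValP lay Ω v₀ (ι.symm a) (ι.symm b) l

/-- the edge of layer `s` along the vertex sequence `y`: from `y s` to `y (s+1)`. [definition of the cell] -/
def edgeAt (lay : Fin T → V → V → Option (WEdge K)) (y : Fin (T + 1) → V) (s : Fin T) : Option (WEdge K) :=
  lay s (y s.castSucc) (y s.succ)

/-- `IsLayWalk lay v₀ y`: the vertex sequence `y : Fin (T+1) → V` starts at `v₀` and follows present edges layer by layer.
[definition of the cell] -/
def IsLayWalk (lay : Fin T → V → V → Option (WEdge K)) (v₀ : V) (y : Fin (T + 1) → V) : Prop :=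
  y 0 = v₀ ∧ ∀ s : Fin T, (edgeAt lay y s).isSome

/-- the `Fin`-indexed tropical cost of a vertex sequence at the integer slope `θ`: `Σ_s (a_s − θ·d cls_s)` over its edges
(a missing edge contributes the junk value `0`; only walks matter) — the tree's list-recursive `DPR.walkCost` in summation
form. [definition of the cell] -/
def walkCostFin (d : Fin K → ℕ) (lay : Fin T → V → V → Option (WEdge K)) (θ : ℤ) (y : Fin (T + 1) → V) : ℤ :=
  ∑ s : Fin T, match edgeAt lay y s with
    | some e => e.a - θ * (d e.cls : ℤ)
    | none => 0

/-- the product of the edge signs along a vertex sequence (junk factor `1` for a missing edge) — the tree's `DPR.walkSign`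
in product form. [definition of the cell] -/
def walkSgnFin (lay : Fin T → V → V → Option (WEdge K)) (y : Fin (T + 1) → V) : ℤ :=
  ∏ s : Fin T, match edgeAt lay y s with
    | some e => e.sgn
    | none => 1

/-- **The walk permutation** of a vertex sequence `y`: on the cycle points `(t, y t)` it steps the layer back cyclically,
`(t, y t) ↦ (t − 1, y (t − 1))` with `(0, y 0) ↦ (T, y T)` (so the column `(t+1, y (t+1))` is sent to the row `(t, y t)` of
its layer entry and the column `(0, y 0)` to the row `(T, y T)` of a back entry); every other pair is fixed.  An explicit
bijection (inverse: step the layer forward on the cycle points). [definition of the cell] -/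
def walkPerm [DecidableEq V] (y : Fin (T + 1) → V) : Equiv.Perm (Fin (T + 1) × V) where
  toFun c := if c.2 = y c.1 then ((finRotate (T + 1)).symm c.1, y ((finRotate (T + 1)).symm c.1)) else c
  invFun c := if c.2 = y c.1 then (finRotate (T + 1) c.1, y (finRotate (T + 1) c.1)) else c
  left_inv c := by
    by_cases h : c.2 = y c.1
    · simp only [h, if_true, Equiv.apply_symm_apply]
      exact Prod.ext rfl h.symm
    · simp only [h, if_false]
  right_inv c := by
    by_cases h : c.2 = y c.1
    · simp only [h, if_true, Equiv.symm_apply_apply]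
      exact Prod.ext rfl h.symm
    · simp only [h, if_false]

/-- the class map of a walk term on pairs: on a cycle point `(t, y t)` of layer `t ≥ 1` the class of the walk's edge of
layer `t − 1` (into `y t`); the padding class `l₀` elsewhere (diagonal columns and the back column `(0, y 0)`).
[definition of the cell] -/
def walkClsP [DecidableEq V] (lay : Fin T → V → V → Option (WEdge K)) (l₀ : Fin K) (y : Fin (T + 1) → V)
    (c : Fin (T + 1) × V) : Fin K :=
  if h : c.2 = y c.1 ∧ c.1 ≠ 0 then
    match edgeAt lay y (c.1.pred h.2) with
    | some e => e.cls
    | none => l₀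
  else l₀

/-- the walk term of `y` on `Fin m` (transported along `ι`): its permutation and class map. [definition of the cell] -/
def walkTerm [DecidableEq V] {m : ℕ} (ι : Fin (T + 1) × V ≃ Fin m) (lay : Fin T → V → V → Option (WEdge K))
    (l₀ : Fin K) (y : Fin (T + 1) → V) : Equiv.Perm (Fin m) × (Fin m → Fin K) :=
  ((ι.symm.trans (walkPerm y)).trans ι, fun a => walkClsP lay l₀ y (ι.symm a))

/-- the identity term on `Fin m`: identity permutation, padding class everywhere. [definition of the cell] -/
def idTerm {m : ℕ} (l₀ : Fin K) : Equiv.Perm (Fin m) × (Fin m → Fin K) := (1, fun _ => l₀)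

end Summit.ValiantsHypothesis.ValiantsHypothesis.Theorems.KPlusLogSqLaw.WalkDesign
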